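import Mathlib
import HarnessLib
import Literature.Analysis.FluidPDE.Tao2016AveragedNS.TaylorChainCertificate
import Summits.NavierStokesRegularity.NavierStokesRegularity.Theorems.TaylorModelRungThreeReadoutPackage
import Summits.NavierStokesRegularity.NavierStokesRegularity.Theorems.TaylorModelRungThreeGDefs
import Summits.NavierStokesRegularity.NavierStokesRegularity.Theorems.TaylorModelRungThreeReadoutWindowBridge
import Summits.NavierStokesRegularity.NavierStokesRegularity.Theorems.TaylorModelRungThreeReadoutG2Land
import Summits.NavierStokesRegularity.NavierStokesRegularity.Theorems.TaylorModelRungThreeReadoutG4Poincare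

/-!
# Line `taylor-model` on crux K1b-DR (stmt-NavierStokesRegularity-23954) — STUB G4 LANDED:
# `stub_landing : LandingC1` (base landing and the C¹ landing allowance of K1b-DR)

The registered stub G4 of skeleton v4.2 (`1e740af7f1414e3e`, line owner ns-idea-2 g3; interface of record
`…Theorems.TaylorModel.LandingC1`, module `…TaylorModelRungThreeGDefs`, p598382):

  `∀ cd φ, cd.Valid → IsWindowFlow cd φ → ChainEnclosure cd φ → Crossing cd φ (tauSel cd φ) →
     KBlockLand cd φ (tauSel cd φ)`.

`KBlockLand` is K1b-DR's landing block verbatim (`yb j := x j 0`, `β := cd.β`): (i) the base point lies in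
the entry polytope (Chain); (ii) BASE LANDING with C¹ allowance `β` — the Readouts `SpI`-landing clause at
the crossing state of the base trajectory (`Crossing`); (iii) for every polytope point `q`, the landing
read-out `σ ↦ ℓ (nx j) l (land j (φ(y_σ, τ(y_σ))) v)` along `y_σ = x 0 + σ (q − x 0)` is differentiable on
`[0,1]` with derivative bounded by `β j l`: the landing POINT is differentiable with `wn ≤ ΛX · dm`
(`G4.hasDerivWithinAt_landingPoint`: Literature variational equation + Poincaré-map derivative + rP-unit
frame transport), the read-out is differentiated by g2's `G2.hasDerivWithinAt_ell_land` (derivative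
`ℓ (landD …)`), and the Readouts `landD` clause (scaled) with `NDL · ΛX · dm ≤ β` closes the bound.

MODEL-lattice bookkeeping only (rung TL-M3 of the NS ladder, Tao-type cascade model); nothing here is a
statement about the Navier–Stokes equations, and NS regularity is not touched.
-/

noncomputable section

-- the sub-problem namespace repeats the summit name by design (D-0017)
set_option linter.dupNamespace false

namespace Summit.NavierStokesRegularity.NavierStokesRegularity.Theorems.TaylorModelReadout.G4

open scoped BigOperators Topology
open Set Literature.Analysis.FluidPDE.TaoCascade Literature.Analysis.FluidPDE.TaoCascade.TaylorChain

variable {cd : CertData} {φ : Flow} {j : ℕ}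

/-- The crossing state of a polytope point, as `TP (S−1) u + w'` with `u` in the last sub-step and
`w' ∈ Ball(Sp (S−1))`, at level `σf = lev` — the shape of the Readouts crossing clauses. [folklore] -/
theorem crossing_shape (hV : cd.Valid) (hj : j ≤ cd.N₀) (hX : Crossing cd φ (tauSel cd φ))
    {q : Fin 4 → ℤ → ℝ} (hq : InPoly cd j q) :
    tauSel cd φ j q - cd.Tn j (cd.S j - 1) ∈ Icc 0 (cd.h j (cd.S j - 1)) ∧
    cd.InBall j (stAt φ j q (tauSel cd φ j q) - cd.TP j (cd.S j - 1) (tauSel cd φ j q - cd.Tn j (cd.S j - 1)))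
      (cd.Sp j (cd.S j - 1)) ∧
    cd.σf j (cd.TP j (cd.S j - 1) (tauSel cd φ j q - cd.Tn j (cd.S j - 1)) +
      (stAt φ j q (tauSel cd φ j q) - cd.TP j (cd.S j - 1) (tauSel cd φ j q - cd.Tn j (cd.S j - 1)))) = cd.lev j := by
  obtain ⟨-, -, h3, -, h5, -⟩ := hX j hj q hq
  refine ⟨(tauSel_mem hV hj hX hq).2.2, h5, ?_⟩
  rw [add_sub_cancel]; exact h3

/-- **The landing block of K1b-DR** for an arbitrary flow package (hypothesis form over `IsFlowPackage`).
[folklore] -/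
theorem kBlockLand_of_package (hV : cd.Valid) (hF : IsFlowPackage cd φ) (hC : ChainEnclosure cd φ)
    (hX : Crossing cd φ (tauSel cd φ)) : KBlockLand cd φ (tauSel cd φ) := by
  intro j hj
  have hω := G3.omega_pos hV hj
  have hx0 : InPoly cd j (cd.x j 0) := inPoly_x0 hV hj
  set s := cd.S j - 1 with hsdef
  have hs : s < cd.S j := S_sub_one_lt hV hj
  refine ⟨hx0, fun v hv l => ⟨?_, fun q hq => ?_⟩⟩
  · -- (ii) base landing with C¹ allowance
    obtain ⟨hu, hw, hlev⟩ := crossing_shape hV hj hX hx0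
    obtain ⟨-, -, -, -, -, hI⟩ := hX j hj (cd.x j 0) hx0
    have h := base_landing hV hj _ hu _ hI hlev v hv l
    rw [add_sub_cancel] at h
    exact h
  · -- (iii) the landing read-out along the segment is C¹ with derivative ≤ β
    have hsegP : ∀ σ' ∈ Icc (0:ℝ) 1, InPoly cd j (seg cd j q σ') := fun σ' hσ' => inPoly_seg hx0 hq hσ'
    -- derivative and bound at each σ
    have key : ∀ σ ∈ Icc (0:ℝ) 1, ∃ G' : ℝ,
        HasDerivWithinAt (fun σ' => cd.ℓ (cd.nx j) l
          (cd.land j (stAt φ j (seg cd j q σ') (tauSel cd φ j (seg cd j q σ'))) v)) G' (Icc 0 1) σ ∧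
        |G'| ≤ cd.β j l := by
      intro σ hσ
      obtain ⟨p', hp', hbd⟩ := hasDerivWithinAt_landingPoint hV hj hF hC hX hq hσ
      obtain ⟨hu, hw, hlev⟩ := crossing_shape hV hj hX (hsegP σ hσ)
      obtain ⟨has, -, hND⟩ := crossing_readouts hV hj _ hu _ hw hlev
      simp only [add_sub_cancel] at has hND
      have hPw : cd.Wsupp (stAt φ j (seg cd j q σ) (tauSel cd φ j (seg cd j q σ))) := G3.wsupp_stAt hF hj _ _
      have hP0 : ofVec cd ((fun σ' => toVec cd (stAt φ j (seg cd j q σ') (tauSel cd φ j (seg cd j q σ')))) σ)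
          cd.i₀ 1 ≠ 0 := by
        show ofVec cd (toVec cd (stAt φ j (seg cd j q σ) (tauSel cd φ j (seg cd j q σ)))) cd.i₀ 1 ≠ 0
        rw [ofVec_toVec_of_wsupp cd hPw]
        intro h0
        have h1 := lt_of_lt_of_le (as_pos hV hj) has
        rw [h0, abs_zero] at h1
        exact lt_irrefl _ h1
      have hd := G2.hasDerivWithinAt_ell_land cd j (cd.nx j) l v hp' hP0
      simp only [ofVec_toVec_of_wsupp cd (G3.wsupp_stAt hF hj _ _)] at hd
      refine ⟨_, hd, ?_⟩
      -- the bound: Readouts landD clause scaled, then NDL · ΛX · dm ≤ β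
      obtain ⟨hNDL, hβ⟩ := NDL_clause hV hj l
      have hsc := scale_ball (j := j)
        (f := fun z => cd.ℓ (cd.nx j) l (cd.landD j (stAt φ j (seg cd j q σ) (tauSel cd φ j (seg cd j q σ))) v z))
        (fun r z => by simp only [landD_smul, map_smul, smul_eq_mul]) (hND v l hv) (wsupp_ofVec cd p')
        (wn_nonneg j p') (inBall_ofVec_wn hω p')
      calc |cd.ℓ (cd.nx j) l (cd.landD j (stAt φ j (seg cd j q σ) (tauSel cd φ j (seg cd j q σ))) v (ofVec cd p'))|
          ≤ cd.NDL j l * wn cd j p' := hsc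
        _ ≤ cd.NDL j l * (cd.ΛX j * cd.dm j) := mul_le_mul_of_nonneg_left hbd hNDL
        _ = cd.NDL j l * cd.ΛX j * cd.dm j := by ring
        _ ≤ cd.β j l := hβ
    refine ⟨fun σ => derivWithin (fun σ' => cd.ℓ (cd.nx j) l
      (cd.land j (stAt φ j (seg cd j q σ') (tauSel cd φ j (seg cd j q σ'))) v)) (Icc 0 1) σ, fun σ hσ => ?_⟩
    obtain ⟨G', hG', hbound⟩ := key σ hσ
    beta_reduce
    rw [hG'.derivWithin (uniqueDiffOn_Icc zero_lt_one σ hσ)]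
    exact ⟨hG', hbound⟩

end Summit.NavierStokesRegularity.NavierStokesRegularity.Theorems.TaylorModelReadout.G4

namespace Summit.NavierStokesRegularity.NavierStokesRegularity.Theorems.TaylorModel

open Summit.NavierStokesRegularity.NavierStokesRegularity.Theorems.TaylorModelReadout

/-- **STUB G4 `stub_landing : LandingC1`** (skeleton v4.2 of line `taylor-model` on K1b-DR, BY NAME): a valid
certificate, a window flow, the chain enclosure and the crossing facts give K1b-DR's landing block for
`τ := tauSel`. MODEL rung TL-M3 only. [folklore] -/
theorem stub_landing : Summit.NavierStokesRegularity.NavierStokesRegularity.Theorems.TaylorModel.LandingC1 :=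
  fun _cd _φ hV hW hC hX => G4.kBlockLand_of_package hV (isFlowPackage_of_isWindowFlow hV hW) hC hX

end Summit.NavierStokesRegularity.NavierStokesRegularity.Theorems.TaylorModel

end
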